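import Summits.KontsevichZagierPeriods.Zeta5Search.Certificates.RecordRayDenominatorsCellsC
import HarnessLib

/-!
# ζ(5) search — the record ray's DENOMINATORS, VII: the 20-window atlas and the hypothesis-free exponent `0.536` (TYPER g15)

HONEST FRAMING: systematic search; no irrationality claim unless certified.

OUR work (Summit side; typer seat, generation 15).  The multiplier `MW n = M0 n / Φ_n` with
`Φ_n = ∏_i (∏_{A_i n < p ≤ B_i n} p)^{k_i}` over the 20 windows of files VI-a/b/c (tables `AZw`, `BZw`, `wQw` of file VI-a: the four
big-prime windows of file IV and sixteen record-cell windows): `MW·P_n ∈ ℤ`, `MW·Q(a·n) ∈ ℤ` (`multiWindowProd_dvd_int`, window by window),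
`Φ_n ≥ e^{(389293 / 1560 − ε)n}` by the prime number theorem (`Σ k_i(B_i − A_i) = 389293 / 1560 = 249.5468`), so
`MW n ≤ e^{(131.9764 + ε)n}` and

* `record_exponent_cells` — **hypothesis-free: for every `0 ≤ γ ≤ 0.536`, eventually `|ζ(5) − P_n/Q(a·n)| < 1/q_n^γ`** with the
  integers `p_n = MW n·P_n`, `q_n = MW n·|Q(a·n)|` (file IV: `0.4949`; Brown–Zudilin print `0.86` from the observed (28)–(30)).

No irrationality content (`γ < 1`).  To add a window: one lemma of the shape of `wCell*` + one entry in the tables (done in files VIII/IX).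
-/

noncomputable section

open Finset Real Filter Topology

namespace Summit.KontsevichZagierPeriods.Zeta5Search.RecordRay

open Summit.KontsevichZagierPeriods.Zeta5Search.DualSeries
open Summit.KontsevichZagierPeriods.Zeta5Search.DualSeriesDenominators
open Summit.KontsevichZagierPeriods.Zeta5Search.WedgeDictionary
open Summit.KontsevichZagierPeriods.Zeta5Search.DualSeriesLemma19 (bRecord)
open Literature.NumberTheory.Irrationality.Hata1992
open Literature.NumberTheory.Transcendental (zetaValue)

/-- The windows are genuine intervals (integer table, by evaluation). -/
theorem AZ_le_BZ : ∀ i : Fin 20, AZw i ≤ BZw i := by decide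

/-- The windows are pairwise separated (integer table, by evaluation). -/
theorem windowsW_separated : ∀ i j : Fin 20, i ≠ j → BZw i ≤ AZw j ∨ BZw j ≤ AZw i := by decide

/-- `Σ_i k_i (BZ_i − AZ_i) = 1167879` (`= 4680 · 389293 / 1560`; integer table, by evaluation). -/
theorem window_rateZw : ∑ i : Fin 20, wQw i * (BZw i - AZw i) = 1167879 := by decide

/-- The window factor `Φ_n`. -/
def corrW (n : ℕ) : ℕ := multiWindowProd Finset.univ AwinW BwinW wQw n

/-- **The multiplier** `MW n = M0 n / Φ_n`. -/
def MW (n : ℕ) : ℚ := M0 n / (corrW n : ℚ)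

/-- `Φ_n > 0`. -/
theorem corrW_pos (n : ℕ) : 0 < corrW n := multiWindowProd_pos _ _ _ _ _

/-- `0 < MW n`. -/
theorem MW_pos (n : ℕ) : 0 < MW n := div_pos (M0_pos n) (by exact_mod_cast corrW_pos n)

/-- `0 ≤ A_i ≤ B_i` over `ℝ`. -/
theorem AwinW_le_BwinW : ∀ i ∈ (Finset.univ : Finset (Fin 20)), 0 ≤ AwinW i ∧ AwinW i ≤ BwinW i := by
  intro i _
  have h : (AZw i : ℝ) ≤ BZw i := by exact_mod_cast AZ_le_BZ i
  refine ⟨by unfold AwinW; positivity, ?_⟩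
  unfold AwinW BwinW
  exact div_le_div_of_nonneg_right h (by norm_num)

/-- `Σ_i k_i (B_i − A_i) = 389293 / 1560` over `ℝ`. -/
theorem window_rateW : ∑ i ∈ (Finset.univ : Finset (Fin 20)), (wQw i : ℝ) * (BwinW i - AwinW i) = 389293 / 1560 := by
  have h : ∀ i : Fin 20, (wQw i : ℝ) * (BwinW i - AwinW i) = ((wQw i * (BZw i - AZw i) : ℕ) : ℝ) / 4680 := by
    intro i
    have hle := AZ_le_BZ i
    unfold AwinW BwinW
    push_cast [Nat.cast_sub hle]
    ring
  rw [Finset.sum_congr rfl fun i _ => h i, ← Finset.sum_div]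
  have hz : ((∑ i : Fin 20, wQw i * (BZw i - AZw i) : ℕ) : ℝ) = 1167879 := by exact_mod_cast window_rateZw
  rw [← Nat.cast_sum, hz]
  norm_num

/-- A prime of window `i`: prime, `A_i n < p ≤ B_i n`. -/
theorem windowW_prime {n : ℕ} {i : Fin 20} {p : ℕ} (hp : p ∈ windowPrimes (AwinW i) (BwinW i) n) :
    p.Prime ∧ AwinW i * n < p ∧ (p : ℝ) ≤ BwinW i * n :=
  (mem_windowPrimes_iff (AwinW_le_BwinW i (Finset.mem_univ _)).1).1 hp

/-- The windows are pairwise disjoint. -/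
theorem windowsW_disjoint (n : ℕ) : ∀ i ∈ (Finset.univ : Finset (Fin 20)), ∀ j ∈ (Finset.univ : Finset (Fin 20)), i ≠ j →
    Disjoint (windowPrimes (AwinW i) (BwinW i) n) (windowPrimes (AwinW j) (BwinW j) n) := by
  intro i _ j _ hij
  rw [Finset.disjoint_left]
  intro p hpi hpj
  obtain ⟨-, a1, b1⟩ := windowW_prime hpi
  obtain ⟨-, a2, b2⟩ := windowW_prime hpj
  have hn : (0 : ℝ) ≤ n := Nat.cast_nonneg n
  rcases windowsW_separated i j hij with h | h
  · have h' : BwinW i ≤ AwinW j := by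
      unfold AwinW BwinW; exact div_le_div_of_nonneg_right (by exact_mod_cast h) (by norm_num)
    nlinarith [mul_le_mul_of_nonneg_right h' hn]
  · have h' : BwinW j ≤ AwinW i := by
      unfold AwinW BwinW; exact div_le_div_of_nonneg_right (by exact_mod_cast h) (by norm_num)
    nlinarith [mul_le_mul_of_nonneg_right h' hn]

/-- **The window divisibilities** (`n ≥ 42`): for every window `i` and every prime `p` in it, `p^{k_i}` divides the multiplied
wedge and the multiplied Q-minor. -/
theorem windowsW_dvd {n : ℕ} (hn : 42 ≤ n)
    {zW zV zW' zV' zU zU' : ℤ}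
    (hzW : dRec n ^ 3 * sharpNormaliser (bRecord n) * coeffW (bRecord n) = zW)
    (hzV : dRec n ^ 6 * sharpNormaliser (bRecord n) * coeffV (bRecord n) = zV)
    (hzW' : dRec n ^ 3 * sharpNormaliser (bRecord' n) * coeffW (bRecord' n) = zW')
    (hzV' : dRec n ^ 6 * sharpNormaliser (bRecord' n) * coeffV (bRecord' n) = zV')
    (hzU : dRec n * sharpNormaliser (bRecord n) * coeffU (bRecord n) = zU)
    (hzU' : dRec n * sharpNormaliser (bRecord' n) * coeffU (bRecord' n) = zU') :
    ∀ i ∈ (Finset.univ : Finset (Fin 20)), ∀ p ∈ windowPrimes (AwinW i) (BwinW i) n,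
      ((p : ℤ) ^ wQw i ∣ (zW' * zV - zW * zV')) ∧
      ((p : ℤ) ^ wQw i ∣ ((Nat.lcmUpto (41 * n) : ℤ) ^ 5 * (zU * zW') - (Nat.lcmUpto (41 * n) : ℤ) ^ 5 * (zU' * zW))) := by
  intro i _ p hp
  obtain ⟨hpr, h1, h2⟩ := windowW_prime hp
  fin_cases i
  · exact (wBig0 hn hpr h1 h2 hzW hzV hzW' hzV' hzU hzU')
  · exact (wBig1 hn hpr h1 h2 hzW hzV hzW' hzV' hzU hzU')
  · exact (wBig2 hn hpr h1 h2 hzW hzV hzW' hzV' hzU hzU')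
  · exact (wBig3 hn hpr h1 h2 hzW hzV hzW' hzV' hzU hzU')
  · exact (wCell0 hn hpr h1 h2 hzW hzV hzW' hzV' hzU hzU')
  · exact (wCell1 hn hpr h1 h2 hzW hzV hzW' hzV' hzU hzU')
  · exact (wCell2 hn hpr h1 h2 hzW hzV hzW' hzV' hzU hzU')
  · exact (wCell3 hn hpr h1 h2 hzW hzV hzW' hzV' hzU hzU')
  · exact (wCell4 hn hpr h1 h2 hzW hzV hzW' hzV' hzU hzU')
  · exact (wCell5 hn hpr h1 h2 hzW hzV hzW' hzV' hzU hzU')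
  · exact (wCell6 hn hpr h1 h2 hzW hzV hzW' hzV' hzU hzU')
  · exact (wCell7 hn hpr h1 h2 hzW hzV hzW' hzV' hzU hzU')
  · exact (wCell8 hn hpr h1 h2 hzW hzV hzW' hzV' hzU hzU')
  · exact (wCell9 hn hpr h1 h2 hzW hzV hzW' hzV' hzU hzU')
  · exact (wCell10 hn hpr h1 h2 hzW hzV hzW' hzV' hzU hzU')
  · exact (wCell11 hn hpr h1 h2 hzW hzV hzW' hzV' hzU hzU')
  · exact (wCell12 hn hpr h1 h2 hzW hzV hzW' hzV' hzU hzU')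
  · exact (wCell13 hn hpr h1 h2 hzW hzV hzW' hzV' hzU hzU')
  · exact (wCell14 hn hpr h1 h2 hzW hzV hzW' hzV' hzU hzU')
  · exact (wCell15 hn hpr h1 h2 hzW hzV hzW' hzV' hzU hzU')

/-- **`MW n · P_n ∈ ℤ`** (`n ≥ 42`). -/
theorem MW_mul_recordP_int {n : ℕ} (hn : 42 ≤ n) : ∃ z : ℤ, MW n * recordP n = z := by
  classical
  have hn1 : 1 ≤ n := by omega
  obtain ⟨⟨zU, hzU⟩, ⟨zW, hzW⟩, ⟨zV, hzV⟩, ⟨zU', hzU'⟩, ⟨zW', hzW'⟩, ⟨zV', hzV'⟩⟩ := sharp_ints hn1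
  obtain ⟨s, -, hρ⟩ := exists_sign_mul_abs _ (rhoOf_aRec_ne_zero n)
  have habs : |rhoOf (aRec n)| ≠ 0 := abs_ne_zero.2 (rhoOf_aRec_ne_zero n)
  have hdiv : rhoOf (aRec n) / |rhoOf (aRec n)| = s := by rw [div_eq_iff habs]; exact hρ
  have key : M0 n * recordP n = (rhoOf (aRec n) / |rhoOf (aRec n)|) *
      ((dRec n ^ 3 * sharpNormaliser (bRecord' n) * coeffW (bRecord' n)) *
      (dRec n ^ 6 * sharpNormaliser (bRecord n) * coeffV (bRecord n)) -
      (dRec n ^ 3 * sharpNormaliser (bRecord n) * coeffW (bRecord n)) *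
      (dRec n ^ 6 * sharpNormaliser (bRecord' n) * coeffV (bRecord' n))) := by
    unfold M0 recordP
    field_simp
  rw [hdiv, hzW, hzV, hzW', hzV'] at key
  have hdvd : ((corrW n : ℕ) : ℤ) ∣ (zW' * zV - zW * zV') := by
    apply multiWindowProd_dvd_int
    · intro i hi p hp
      exact ((windowsW_dvd hn hzW hzV hzW' hzV' hzU hzU') i hi p hp).1
    · exact windowsW_disjoint n
  obtain ⟨q, hq⟩ := hdvd
  refine ⟨s * q, ?_⟩
  have hc : (corrW n : ℚ) ≠ 0 := by exact_mod_cast (corrW_pos n).ne'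
  have e : (zW' : ℚ) * zV - zW * zV' = (corrW n : ℚ) * q := by exact_mod_cast hq
  calc MW n * recordP n = M0 n * recordP n / corrW n := by unfold MW; ring
    _ = s * ((zW' : ℚ) * zV - zW * zV') / corrW n := by rw [key]
    _ = ((s * q : ℤ) : ℚ) := by rw [e]; push_cast; field_simp

/-- **`MW n · Q(a·n) ∈ ℤ`** (`n ≥ 42`). -/
theorem MW_mul_recordQ_int {n : ℕ} (hn : 42 ≤ n) : ∃ z : ℤ, MW n * recordQ n = z := by
  classical
  have hn1 : 1 ≤ n := by omega
  obtain ⟨⟨zU, hzU⟩, ⟨zW, hzW⟩, ⟨zV, hzV⟩, ⟨zU', hzU'⟩, ⟨zW', hzW'⟩, ⟨zV', hzV'⟩⟩ := sharp_ints hn1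
  obtain ⟨s, -, hρ⟩ := exists_sign_mul_abs _ (rhoOf_aRec_ne_zero n)
  have habs : |rhoOf (aRec n)| ≠ 0 := abs_ne_zero.2 (rhoOf_aRec_ne_zero n)
  have hdiv : rhoOf (aRec n) / |rhoOf (aRec n)| = s := by rw [div_eq_iff habs]; exact hρ
  have hQ := recordQ_eq_wedge hn1
  have key : M0 n * recordQ n = (rhoOf (aRec n) / |rhoOf (aRec n)|) * dRec n ^ 5 *
      ((dRec n * sharpNormaliser (bRecord n) * coeffU (bRecord n)) *
      (dRec n ^ 3 * sharpNormaliser (bRecord' n) * coeffW (bRecord' n)) -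
      (dRec n * sharpNormaliser (bRecord' n) * coeffU (bRecord' n)) *
      (dRec n ^ 3 * sharpNormaliser (bRecord n) * coeffW (bRecord n))) := by
    unfold M0
    rw [hQ]
    field_simp
  rw [hdiv, hzU, hzW, hzU', hzW'] at key
  set D : ℤ := (Nat.lcmUpto (41 * n) : ℤ) with hD
  have hdvd : ((corrW n : ℕ) : ℤ) ∣ (D ^ 5 * (zU * zW') - D ^ 5 * (zU' * zW)) := by
    apply multiWindowProd_dvd_int
    · intro i hi p hp
      exact ((windowsW_dvd hn hzW hzV hzW' hzV' hzU hzU') i hi p hp).2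
    · exact windowsW_disjoint n
  obtain ⟨q, hq⟩ := hdvd
  refine ⟨s * q, ?_⟩
  have hc : (corrW n : ℚ) ≠ 0 := by exact_mod_cast (corrW_pos n).ne'
  have hDq : (D : ℚ) = dRec n := by rw [hD]; unfold dRec; push_cast; rfl
  have e : (dRec n) ^ 5 * ((zU : ℚ) * zW' - zU' * zW) = (corrW n : ℚ) * q := by
    rw [← hDq]; exact_mod_cast (by rw [← hq]; ring : D ^ 5 * (zU * zW' - zU' * zW) = (corrW n : ℤ) * q)
  calc MW n * recordQ n = M0 n * recordQ n / corrW n := by unfold MW; ring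
    _ = s * (dRec n ^ 5 * ((zU : ℚ) * zW' - zU' * zW)) / corrW n := by rw [key]; ring
    _ = ((s * q : ℤ) : ℚ) := by rw [e]; push_cast; field_simp

/-- **Size**: for every `ε > 0`, eventually `MW n ≤ e^{(131.9764 + ε)·n}` (`381.5232 − 249.5468`). -/
theorem eventually_MW_le_exp {ε : ℝ} (hε : 0 < ε) :
    ∀ᶠ n : ℕ in atTop, ((MW n : ℚ) : ℝ) ≤ Real.exp (((3815232 / 10000 - 389293 / 1560 : ℚ) + ε) * n) := by
  have hε2 : 0 < ε / 2 := by positivity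
  have hΦ := eventually_exp_le_multiWindowProd (s := (Finset.univ : Finset (Fin 20))) (w := wQw) AwinW_le_BwinW hε2
  filter_upwards [eventually_M0_le_exp hε2, hΦ] with n hM0 hcorr
  rw [window_rateW] at hcorr
  have hcorr' : Real.exp ((389293 / 1560 - ε / 2) * n) ≤ ((corrW n : ℕ) : ℝ) := hcorr
  have hcpos : (0 : ℝ) < ((corrW n : ℕ) : ℝ) := by exact_mod_cast corrW_pos n
  have hcast : ((MW n : ℚ) : ℝ) = ((M0 n : ℚ) : ℝ) / ((corrW n : ℕ) : ℝ) := by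
    unfold MW; push_cast; rfl
  rw [hcast]
  calc ((M0 n : ℚ) : ℝ) / ((corrW n : ℕ) : ℝ) ≤ Real.exp ((3815232 / 10000 + ε / 2) * n) / ((corrW n : ℕ) : ℝ) :=
        div_le_div_of_nonneg_right hM0 hcpos.le
    _ ≤ Real.exp ((3815232 / 10000 + ε / 2) * n) / Real.exp ((389293 / 1560 - ε / 2) * n) :=
        div_le_div_of_nonneg_left (Real.exp_pos _).le (Real.exp_pos _) hcorr'
    _ = Real.exp (((3815232 / 10000 - 389293 / 1560 : ℚ) + ε) * n) := by rw [← Real.exp_sub]; push_cast; ring_nf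

/-- **THE EXPONENT `0.536`, hypothesis-free.**  For every `0 ≤ γ ≤ 0.536`, eventually
`|ζ(5) − P_n/Q(a·n)| < 1/q_n^γ` with the integers `p_n = MW n·P_n`, `q_n = MW n·|Q(a·n)| ≥ 1`.
Arithmetic: `0.536·(131.9764 + 0.02 + 85.08768884) < 85.08768883 + 31.5452`.  No irrationality content (`γ < 1`). -/
theorem record_exponent_cells {γ : ℝ} (hγ0 : 0 ≤ γ) (hγ : γ ≤ 536 / 1000) :
    ∀ᶠ n : ℕ in atTop, ∃ p : ℤ, ∃ q : ℕ, 1 ≤ q ∧ (q : ℚ) = MW n * |(recordQ n : ℚ)| ∧ (p : ℚ) = MW n * recordP n ∧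
      |zetaValue 5 - (recordP n : ℝ) / (recordQ n : ℝ)| < 1 / (q : ℝ) ^ γ := by
  refine record_exponent_rat (lam := ((3815232 / 10000 - 389293 / 1560 : ℚ) : ℝ) + 2 / 100) MW ?_ hγ0 (by push_cast; nlinarith)
  filter_upwards [eventually_MW_le_exp (show (0 : ℝ) < 2 / 100 by norm_num), eventually_ge_atTop 42] with n hn hn42
  exact ⟨MW_pos n, MW_mul_recordP_int hn42, MW_mul_recordQ_int hn42, hn⟩

end Summit.KontsevichZagierPeriods.Zeta5Search.RecordRay
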